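import Literature.AnabelianGeometry.AbsoluteAnabelian.GaloisCyclotomeAction
import HarnessLib

/-!
# `μ_{ℚ/ℤ}(G)`: bookkeeping for the Verlagerung on torsion under conjugation and equal subgroups

Mochizuki, *Topics in Absolute Anabelian Geometry III*, §1, Cor. 1.10 (i)(a), manuscript p. 42
(`μ_{ℚ/ℤ}(G_k) := lim_{→ H} (H^ab)_tors`, "the arrows of the direct limit are induced by the
Verlagerung"), and [AbsAnab] Prop. 1.2.1 (vi) p. 10 (compatibility of the local reciprocity maps
of the open subgroups of `G_k` with conjugation).  PROOF-ONLY group-theoretic auxiliaries (abc-iut-L6-t11,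
discharge of `MLFGaloisCyclotomeIsRootsOfUnity`) over the REAL `verlagerungTorsion` / `torsionTransport` /
`imageOpenSubgroup` of `GaloisCyclotome*.lean` (abc-iut-L4-t1), stated so that no transport of DATA along
an equality of subgroups is ever needed:

* `verlagerungTorsion_ker_congr` — "the Verlagerung `U^ab → V^ab` kills no torsion" only depends on
  the subgroups `U`, `V` (not on the expressions naming them);
* `torsionTransport_injective`, `coe_torsionTransport_of_eq`, `verlagerungTorsion_eq_one_of_transport`
  — transport of that property along `e : G ≃ₜ* G'` (`torsionTransport_verlagerungTorsion`);
* `coe_verlagerungTorsion_congr_right` — the Verlagerung towards two equal subgroups `V₁ = V₂` has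
  the same value on representatives;
* `mem_imageOpenSubgroup_conj_iff`, `coe_imageOpenSubgroup_conj_of_normal`,
  `le_imageOpenSubgroup_conj_of_normal` — `σUσ⁻¹` as `imageOpenSubgroup (conjContinuousMulEquiv σ) U`,
  and `σNσ⁻¹ = N` for normal `N`.

Topological group theory only; nothing here bears on [IUTchIII] Cor. 3.12.
-/

noncomputable section

universe u

namespace Literature.AnabelianGeometry.AbsoluteAnabelian

section EqualSubgroups

variable {G : Type u} [Group G] [TopologicalSpace G] [IsTopologicalGroup G] [CompactSpace G]

/-- "The Verlagerung `U^ab → V^ab` kills no torsion class" only depends on the subgroups `U`, `V`.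
[cite: MochizukiAbsTopIII2015, Cor 1.10 (i) p.42] -/
theorem verlagerungTorsion_ker_congr {U₁ U₂ V₁ V₂ : Subgroup G} (hU : U₁ = U₂) (hV : V₁ = V₂)
    (hU₁ : IsOpen (U₁ : Set G)) (hU₂ : IsOpen (U₂ : Set G)) (hV₁ : IsOpen (V₁ : Set G))
    (hV₂ : IsOpen (V₂ : Set G)) (h₁ : V₁ ≤ U₁) (h₂ : V₂ ≤ U₂) :
    (∀ x, verlagerungTorsion hU₁ hV₁ h₁ x = 1 → x = 1) ↔
      (∀ x, verlagerungTorsion hU₂ hV₂ h₂ x = 1 → x = 1) := by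
  subst hU hV
  exact Iff.rfl

/-- The Verlagerung towards two equal open subgroups `V₁ = V₂` has the same value on representatives.
[cite: MochizukiAbsTopIII2015, Cor 1.10 (i) p.42] -/
theorem coe_verlagerungTorsion_congr_right {U V₁ V₂ : Subgroup G} (hV : V₁ = V₂)
    (hU : IsOpen (U : Set G)) (hV₁ : IsOpen (V₁ : Set G)) (hV₂ : IsOpen (V₂ : Set G))
    (h₁ : V₁ ≤ U) (h₂ : V₂ ≤ U) (x : abelianizationTorsion U) (v : V₁)
    (hx : (verlagerungTorsion hU hV₁ h₁ x).1 = QuotientGroup.mk v) :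
    (verlagerungTorsion hU hV₂ h₂ x).1 = QuotientGroup.mk ⟨v.1, hV ▸ v.2⟩ := by
  subst hV
  exact hx

end EqualSubgroups

section Transport

variable {G : Type u} [Group G] [TopologicalSpace G] [IsTopologicalGroup G] [CompactSpace G]
  {G' : Type u} [Group G'] [TopologicalSpace G'] [IsTopologicalGroup G'] [CompactSpace G']

omit [CompactSpace G] [CompactSpace G'] in
/-- Torsion transport along `e : G ≃ₜ* G'` is injective (it is a restriction of `(e(U))^ab ≅ U^ab`).
[cite: MochizukiAbsTopIII2015, Cor 1.10 (i) p.42] -/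
theorem torsionTransport_injective (e : G ≃ₜ* G') (U : OpenSubgroup G) :
    Function.Injective (torsionTransport e U) := by
  intro x y h
  apply Subtype.ext
  have h1 := congrArg Subtype.val h
  rw [coe_torsionTransport, coe_torsionTransport] at h1
  exact (abelianizationCongr _).symm.injective h1

omit [CompactSpace G] [CompactSpace G'] in
/-- Torsion transport on a class given by a representative: `[u] ↦ [e u]`.
[cite: MochizukiAbsTopIII2015, Cor 1.10 (i) p.42] -/
theorem coe_torsionTransport_of_eq (e : G ≃ₜ* G') (U : OpenSubgroup G)
    (x : abelianizationTorsion (U : Subgroup G)) (u : (U : Subgroup G))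
    (hx : x.1 = QuotientGroup.mk u) :
    (torsionTransport e U x).1 = QuotientGroup.mk ⟨e u, apply_mem_imageOpenSubgroup e U u.2⟩ := by
  rw [coe_torsionTransport, hx]
  exact abelianizationCongr_symm_mk _ _

/-- If the Verlagerung `e(U)^ab → e(V)^ab` kills no torsion class, neither does `U^ab → V^ab`
(transport along `e : G ≃ₜ* G'`, `torsionTransport_verlagerungTorsion`).
[cite: MochizukiAbsTopIII2015, Cor 1.10 (i) p.42] -/
theorem verlagerungTorsion_eq_one_of_transport (e : G ≃ₜ* G') {U V : OpenSubgroup G}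
    (h : (V : Subgroup G) ≤ U)
    (H : ∀ y, verlagerungTorsion (imageOpenSubgroup e U).isOpen (imageOpenSubgroup e V).isOpen
      (Subgroup.comap_mono h) y = 1 → y = 1)
    (x : abelianizationTorsion (U : Subgroup G)) (hx : verlagerungTorsion U.isOpen V.isOpen h x = 1) :
    x = 1 := by
  have h1 := torsionTransport_verlagerungTorsion e h x
  rw [hx, map_one] at h1
  apply torsionTransport_injective e U
  rw [map_one]
  exact H _ h1.symm

end Transport

section Conj

variable {G : Type u} [Group G] [TopologicalSpace G] [IsTopologicalGroup G] [CompactSpace G]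

omit [CompactSpace G] in
/-- Membership in `σUσ⁻¹ = imageOpenSubgroup (conj σ) U`: `g ∈ σUσ⁻¹ ↔ σ⁻¹ g σ ∈ U`.
[cite: MochizukiAbsTopIII2015, Cor 1.10 (i) p.42] -/
theorem mem_imageOpenSubgroup_conj_iff (σ : G) (U : OpenSubgroup G) (g : G) :
    g ∈ imageOpenSubgroup (conjContinuousMulEquiv σ) U ↔ σ⁻¹ * g * σ ∈ U := by
  change (conjContinuousMulEquiv σ).symm g ∈ U ↔ _
  have h1 : (conjContinuousMulEquiv σ).symm g = σ⁻¹ * g * σ := by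
    rw [ContinuousMulEquiv.symm_apply_eq, conjContinuousMulEquiv_apply]
    group
  rw [h1]

omit [CompactSpace G] in
/-- `σNσ⁻¹ = N` for a normal open subgroup `N` (as subgroups).
[cite: MochizukiAbsTopIII2015, Cor 1.10 (i) p.42] -/
theorem coe_imageOpenSubgroup_conj_of_normal (σ : G) (N : OpenSubgroup G)
    (hN : (N : Subgroup G).Normal) :
    ((imageOpenSubgroup (conjContinuousMulEquiv σ) N : OpenSubgroup G) : Subgroup G) = N := by
  ext g
  rw [OpenSubgroup.mem_toSubgroup, mem_imageOpenSubgroup_conj_iff, OpenSubgroup.mem_toSubgroup]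
  constructor
  · intro h
    have h' := hN.conj_mem _ h σ
    simpa [mul_assoc] using h'
  · intro h
    have h' := hN.conj_mem _ h σ⁻¹
    simpa [mul_assoc] using h'

omit [CompactSpace G] in
/-- A normal subgroup `N ≤ U` satisfies `N ≤ σUσ⁻¹`. [cite: MochizukiAbsTopIII2015, Cor 1.10 (i) p.42] -/
theorem le_imageOpenSubgroup_conj_of_normal (σ : G) {N : Subgroup G} (hN : N.Normal)
    {U : OpenSubgroup G} (h : N ≤ U) :
    N ≤ ((imageOpenSubgroup (conjContinuousMulEquiv σ) U : OpenSubgroup G) : Subgroup G) := by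
  intro g hg
  rw [OpenSubgroup.mem_toSubgroup, mem_imageOpenSubgroup_conj_iff]
  have h' := hN.conj_mem _ hg σ⁻¹
  rw [inv_inv] at h'
  exact h h'

end Conj

end Literature.AnabelianGeometry.AbsoluteAnabelian
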